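import Mathlib
import HarnessLib

/-!
# The leaf profile ODE `y'' = ½ − (C/2) e^y` of a degenerate three-dimensional shrinker

Real-variable lemmas for the degenerate case of the classification of complete three-dimensional
gradient shrinking Ricci solitons (Munteanu–Wang 2016, Thm. 1.2; the step "a compact
two-dimensional shrinker is round", Hamilton 1988, §10). Along a leafwise unit-speed geodesic from
a critical point of the potential, `y = f ∘ γ` solves `y'' = ½ − (C/2) e^y` with `y'(0) = 0` and the
normalisation `y'² = y − C e^y`, and the normal Jacobi field is `j = y'/y''(0)`; all geodesics from
the point carry the same profile. This file provides:

* `eq_of_hasDerivAt_two_linear` — uniqueness for the scalar linear equation `u'' = −k(t) u`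
  (`k` continuous): zero data give `u ≡ 0`; `eq_of_hasDerivAt_two_autonomous` — uniqueness for
  `y'' = Φ(y)`, `Φ` of class `C¹` (Grönwall, `ODE_solution_unique_of_mem_Ioo`);
* `exists_first_zero_deriv_of_profile` — for a solution with `y'(0) = 0`, `y''(0) > 0`: the first
  positive zero `τ` of `y'`, with `y' > 0` on `(0, τ)`, `y(0) < y(τ)` and `y''(τ) < 0` (strict
  concavity of `y ↦ y − C e^y`);
* `jacobi_eq_deriv_div` — a solution of `j'' = −(C/2) e^{y} j`, `j(0) = 0`, `j'(0) = 1` is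
  `y'/y''(0)`;
* `rotation_number_eq_one` — a `2π`-periodic unit planar curve `(α, β)` with constant speed
  `c > 0`, injective on `[0, 2π)`, has `c = 1`;
* `eq_of_eq_mul_exp_of_add_eq_two` — `x = C eˣ`, `y = C eʸ`, `x + y = 2` force `x = y`
  (`2d < log((1+d)/(1−d))` on `(0,1)`).

Everything is proved; no definitions are introduced.

## References

* O. Munteanu, J. Wang, arXiv:1606.01861, Thm. 1.1, Thm. 1.2 (p. 3). [MunteanuWang2016]
* R. S. Hamilton, *The Ricci flow on surfaces*, Contemp. Math. 71 (1988), §10. [Hamilton1988]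
-/

noncomputable section

open Set Filter Metric Real
open scoped Topology

namespace Literature.Analysis.ODE.ShrinkerLeafProfile

/-! ### Uniqueness for second-order equations via the first-order system -/

/-- **Zero data for `u'' = −k(t) u` force `u ≡ 0`** (`k` continuous on `ℝ`): the pair `(u, u')`
solves a linear system whose right-hand side is Lipschitz on every bounded time interval.
[folklore] -/
theorem eq_zero_of_hasDerivAt_two_linear {k : ℝ → ℝ} (hk : Continuous k) {u u₁ : ℝ → ℝ}
    (hu : ∀ t, HasDerivAt u (u₁ t) t) (hu₁ : ∀ t, HasDerivAt u₁ (-k t * u t) t)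
    (h0 : u 0 = 0) (h0' : u₁ 0 = 0) (t : ℝ) : u t = 0 := by
  -- a symmetric time interval and a bound for `|k|` on it
  set T : ℝ := |t| + 1 with hT
  have hT0 : 0 < T := by positivity
  obtain ⟨Kb, hKb⟩ := isCompact_Icc.exists_bound_of_continuousOn (s := Icc (-T) T) hk.continuousOn
  set K : NNReal := ⟨max Kb 1, le_trans zero_le_one (le_max_right _ _)⟩ with hK
  -- the first-order system
  set v : ℝ → ℝ × ℝ → ℝ × ℝ := fun s p ↦ (p.2, -k s * p.1) with hv
  have hLip : ∀ s ∈ Ioo (-T) T, LipschitzOnWith K (v s) univ := by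
    intro s hs
    refine LipschitzOnWith.of_dist_le_mul fun p _ q _ ↦ ?_
    have hks : |k s| ≤ max Kb 1 :=
      ((Real.norm_eq_abs _).symm.le.trans (hKb s (Ioo_subset_Icc_self hs))).trans (le_max_left _ _)
    rw [dist_eq_norm, dist_eq_norm, Prod.norm_def, Prod.norm_def]
    simp only [hv, Prod.fst_sub, Prod.snd_sub, Real.norm_eq_abs]
    have h1 : |p.2 - q.2| ≤ max |p.1 - q.1| |p.2 - q.2| := le_max_right _ _
    have h2 : |(-k s * p.1) - (-k s * q.1)| ≤ max Kb 1 * max |p.1 - q.1| |p.2 - q.2| := by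
      rw [show (-k s * p.1) - (-k s * q.1) = -k s * (p.1 - q.1) by ring, abs_mul, abs_neg]
      exact mul_le_mul hks (le_max_left _ _) (abs_nonneg _) (le_trans zero_le_one (le_max_right _ _))
    have hm : 0 ≤ max |p.1 - q.1| |p.2 - q.2| := le_trans (abs_nonneg _) (le_max_left _ _)
    refine max_le (h1.trans ?_) h2
    exact le_mul_of_one_le_left hm (le_max_right _ _)
  have hsol : ∀ s ∈ Ioo (-T) T, HasDerivAt (fun r ↦ (u r, u₁ r)) (v s (u s, u₁ s)) s ∧
      (u s, u₁ s) ∈ (univ : Set (ℝ × ℝ)) := fun s _ ↦ ⟨(hu s).prodMk (hu₁ s), mem_univ _⟩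
  have hzero : ∀ s ∈ Ioo (-T) T, HasDerivAt (fun _ : ℝ ↦ ((0 : ℝ), (0 : ℝ))) (v s (0, 0)) s ∧
      ((0 : ℝ), (0 : ℝ)) ∈ (univ : Set (ℝ × ℝ)) := fun s _ ↦ by
    refine ⟨?_, mem_univ _⟩
    have : v s (0, 0) = (0, 0) := by simp [hv]
    rw [this]
    exact hasDerivAt_const s _
  have h00 : (0 : ℝ) ∈ Ioo (-T) T := ⟨by linarith, hT0⟩
  have heq := ODE_solution_unique_of_mem_Ioo hLip h00 hsol hzero (by simp [h0, h0'])
  have ht : t ∈ Ioo (-T) T := by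
    constructor <;> cases abs_cases t <;> linarith
  have := heq ht
  simp only [Prod.mk.injEq] at this
  exact this.1

/-- **Uniqueness for the linear equation `u'' = −k(t) u`** with prescribed `u(0)`, `u'(0)`.
[folklore] -/
theorem eq_of_hasDerivAt_two_linear {k : ℝ → ℝ} (hk : Continuous k) {u u₁ w w₁ : ℝ → ℝ}
    (hu : ∀ t, HasDerivAt u (u₁ t) t) (hu₁ : ∀ t, HasDerivAt u₁ (-k t * u t) t)
    (hw : ∀ t, HasDerivAt w (w₁ t) t) (hw₁ : ∀ t, HasDerivAt w₁ (-k t * w t) t)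
    (h0 : u 0 = w 0) (h0' : u₁ 0 = w₁ 0) (t : ℝ) : u t = w t := by
  have h := eq_zero_of_hasDerivAt_two_linear hk (u := fun t ↦ u t - w t) (u₁ := fun t ↦ u₁ t - w₁ t)
    (fun t ↦ (hu t).sub (hw t)) (fun t ↦ ((hu₁ t).sub (hw₁ t)).congr_deriv (by ring))
    (by simp [h0]) (by simp [h0']) t
  linarith

/-- **Uniqueness for the autonomous equation `y'' = Φ(y)`**, `Φ` of class `C¹`: two solutions on
`ℝ` with the same `y(0)`, `y'(0)` coincide (on a bounded time interval both stay in a compact set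
on which `Φ` is Lipschitz; Grönwall). [folklore] -/
theorem eq_of_hasDerivAt_two_autonomous {Φ : ℝ → ℝ} (hΦ : ContDiff ℝ 1 Φ) {y y₁ w w₁ : ℝ → ℝ}
    (hy : ∀ t, HasDerivAt y (y₁ t) t) (hy₁ : ∀ t, HasDerivAt y₁ (Φ (y t)) t)
    (hw : ∀ t, HasDerivAt w (w₁ t) t) (hw₁ : ∀ t, HasDerivAt w₁ (Φ (w t)) t)
    (h0 : y 0 = w 0) (h0' : y₁ 0 = w₁ 0) (t : ℝ) : y t = w t := by
  set T : ℝ := |t| + 1 with hT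
  have hT0 : 0 < T := by positivity
  -- both solutions stay in a ball on `[−T, T]`
  have hyc : Continuous y := continuous_iff_continuousAt.2 fun s ↦ (hy s).continuousAt
  have hwc : Continuous w := continuous_iff_continuousAt.2 fun s ↦ (hw s).continuousAt
  obtain ⟨Ry, hRy⟩ := isCompact_Icc.exists_bound_of_continuousOn (s := Icc (-T) T) hyc.continuousOn
  obtain ⟨Rw, hRw⟩ := isCompact_Icc.exists_bound_of_continuousOn (s := Icc (-T) T) hwc.continuousOn
  set R : ℝ := max Ry Rw with hR
  -- `Φ` is Lipschitz on `[-R, R]`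
  obtain ⟨L, hL⟩ : ∃ L : NNReal, LipschitzOnWith L Φ (Icc (-R) R) := by
    have hdc : Continuous (deriv Φ) := hΦ.continuous_deriv le_rfl
    obtain ⟨B, hB⟩ := isCompact_Icc.exists_bound_of_continuousOn (s := Icc (-R) R) hdc.continuousOn
    refine ⟨⟨max B 0, le_max_right _ _⟩, ?_⟩
    refine Convex.lipschitzOnWith_of_nnnorm_deriv_le (𝕜 := ℝ)
      (fun x _ ↦ (hΦ.differentiable (by simp)) x) (fun x hx ↦ ?_) (convex_Icc _ _)
    rw [← NNReal.coe_le_coe, coe_nnnorm]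
    exact (hB x hx).trans (le_max_left B 0)
  set K : NNReal := max L 1 with hK
  -- the first-order system on the slab `[-R, R] × ℝ`
  set v : ℝ → ℝ × ℝ → ℝ × ℝ := fun _ p ↦ (p.2, Φ p.1) with hv
  set S : Set (ℝ × ℝ) := {p | p.1 ∈ Icc (-R) R} with hS
  have hLip : ∀ s ∈ Ioo (-T) T, LipschitzOnWith K (v s) S := by
    intro s _
    refine LipschitzOnWith.of_dist_le_mul fun p hp q hq ↦ ?_
    rw [dist_eq_norm, dist_eq_norm, Prod.norm_def, Prod.norm_def]
    simp only [hv, Prod.fst_sub, Prod.snd_sub, Real.norm_eq_abs]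
    have hm : 0 ≤ max |p.1 - q.1| |p.2 - q.2| := le_trans (abs_nonneg _) (le_max_left _ _)
    have h1 : |p.2 - q.2| ≤ (K : ℝ) * max |p.1 - q.1| |p.2 - q.2| :=
      (le_max_right _ _).trans (le_mul_of_one_le_left hm (by simp [hK]))
    have h2 : |Φ p.1 - Φ q.1| ≤ (K : ℝ) * max |p.1 - q.1| |p.2 - q.2| := by
      have h := hL.dist_le_mul p.1 hp q.1 hq
      rw [dist_eq_norm, dist_eq_norm, Real.norm_eq_abs, Real.norm_eq_abs] at h
      refine h.trans (mul_le_mul (by simp [hK]) (le_max_left _ _) (abs_nonneg _) (by simp))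
    exact max_le h1 h2
  have hyin : ∀ s ∈ Ioo (-T) T, (y s, y₁ s) ∈ S := fun s hs ↦ by
    simp only [hS, mem_setOf_eq, mem_Icc, ← abs_le]
    exact ((Real.norm_eq_abs _).symm.le.trans (hRy s (Ioo_subset_Icc_self hs))).trans
      (le_max_left _ _)
  have hwin : ∀ s ∈ Ioo (-T) T, (w s, w₁ s) ∈ S := fun s hs ↦ by
    simp only [hS, mem_setOf_eq, mem_Icc, ← abs_le]
    exact ((Real.norm_eq_abs _).symm.le.trans (hRw s (Ioo_subset_Icc_self hs))).trans
      (le_max_right _ _)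
  have hsoly : ∀ s ∈ Ioo (-T) T, HasDerivAt (fun r ↦ (y r, y₁ r)) (v s (y s, y₁ s)) s ∧
      (y s, y₁ s) ∈ S := fun s hs ↦ ⟨(hy s).prodMk (hy₁ s), hyin s hs⟩
  have hsolw : ∀ s ∈ Ioo (-T) T, HasDerivAt (fun r ↦ (w r, w₁ r)) (v s (w s, w₁ s)) s ∧
      (w s, w₁ s) ∈ S := fun s hs ↦ ⟨(hw s).prodMk (hw₁ s), hwin s hs⟩
  have h00 : (0 : ℝ) ∈ Ioo (-T) T := ⟨by linarith, hT0⟩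
  have heq := ODE_solution_unique_of_mem_Ioo hLip h00 hsoly hsolw (by simp [h0, h0'])
  have ht : t ∈ Ioo (-T) T := by
    constructor <;> cases abs_cases t <;> linarith
  have := heq ht
  simp only [Prod.mk.injEq] at this
  exact this.1


/-! ### Elementary real-variable lemmas -/

/-- A function vanishing at `0` with positive derivative there is positive on a right
neighbourhood of `0`. [folklore] -/
theorem exists_pos_of_hasDerivAt_pos {g : ℝ → ℝ} {a : ℝ} (hg : HasDerivAt g a 0) (h0 : g 0 = 0)
    (ha : 0 < a) : ∃ ε : ℝ, 0 < ε ∧ ∀ t ∈ Ioo 0 ε, 0 < g t := by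
  have ht : Tendsto (slope g 0) (𝓝[≠] 0) (𝓝 a) := hasDerivAt_iff_tendsto_slope.mp hg
  have hev : ∀ᶠ t in 𝓝[>] (0 : ℝ), 0 < slope g 0 t :=
    nhdsWithin_mono 0 (fun t (ht : 0 < t) ↦ ht.ne') (ht.eventually (lt_mem_nhds ha))
  obtain ⟨ε, hε, hεs⟩ := (nhdsGT_basis (0 : ℝ)).eventually_iff.mp hev
  refine ⟨ε, hε, fun t htI ↦ ?_⟩
  have hs := hεs htI
  rw [slope_def_field, h0, sub_zero, sub_zero] at hs
  exact (div_pos_iff_of_pos_right htI.1).mp hs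

/-- For `F(y) = y − C eʸ` (`C > 0`): if `F(x₀) = 0`, `F(x₁) ≤ 0` and `x₀ < x₁` then
`F'(x₁) = 1 − C e^{x₁} < 0` (mean value theorem and strict monotonicity of `F'`). [folklore] -/
theorem one_sub_mul_exp_neg_of_root {C x₀ x₁ : ℝ} (hC : 0 < C) (h0 : x₀ - C * exp x₀ = 0)
    (h1 : x₁ - C * exp x₁ ≤ 0) (hlt : x₀ < x₁) : 1 - C * exp x₁ < 0 := by
  have hF : ∀ x, HasDerivAt (fun y ↦ y - C * exp y) (1 - C * exp x) x := fun x ↦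
    (hasDerivAt_id x).sub ((Real.hasDerivAt_exp x).const_mul C)
  obtain ⟨ξ, hξ, hξ'⟩ := exists_hasDerivAt_eq_slope (fun y ↦ y - C * exp y)
    (fun x ↦ 1 - C * exp x) hlt
    (HasDerivAt.continuousOn fun x _ ↦ hF x) (fun x _ ↦ hF x)
  have hslope : (x₁ - C * exp x₁ - (x₀ - C * exp x₀)) / (x₁ - x₀) ≤ 0 :=
    div_nonpos_of_nonpos_of_nonneg (by linarith) (by linarith)
  have hξle : 1 - C * exp ξ ≤ 0 := hξ' ▸ hslope
  have hexp : exp ξ < exp x₁ := exp_lt_exp.mpr hξ.2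
  nlinarith [mul_lt_mul_of_pos_left hexp hC]

/-- The normalisation `y'² = y − C eʸ` confines `y`: `0 < y < 4/C`. [folklore] -/
theorem pos_and_lt_of_sq_eq {C y y₁ : ℝ} (hC : 0 < C) (h : y₁ ^ 2 = y - C * exp y) :
    0 < y ∧ y < 4 / C := by
  have hCe : 0 < C * exp y := mul_pos hC (exp_pos y)
  have hy : 0 < y := by nlinarith [sq_nonneg y₁]
  refine ⟨hy, ?_⟩
  have hle : C * exp y ≤ y := by nlinarith [sq_nonneg y₁]
  have h2 : y / 2 + 1 ≤ exp (y / 2) := add_one_le_exp _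
  have h3 : (y / 2 + 1) ^ 2 ≤ exp y := by
    have := pow_le_pow_left₀ (by linarith) h2 2
    rwa [← exp_nat_mul, show ((2 : ℕ) : ℝ) * (y / 2) = y by push_cast; ring] at this
  have h4 : C * (y ^ 2 / 4) < y := by nlinarith
  rw [lt_div_iff₀ hC]
  nlinarith

/-! ### The first zero of `y'` -/

/-- **The first positive zero of `y'` for the leaf profile.** Let `y` solve
`y'' = ½ − (C/2) eʸ` on `ℝ` (`C > 0`) with the normalisation `y'² = y − C eʸ`, `y'(0) = 0` and
`y''(0) > 0`. Then there is `τ > 0` with `y'(τ) = 0`, `y' > 0` on `(0, τ)`, `y(0) < y(τ)` and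
`y''(τ) < 0`. (If `y'` stayed positive, `y` would increase to a limit `L` with
`L − C e^L = lim y'² ≥ 0`; the growth bound `y < 4/C` forces `lim y' = 0`, while by strict
concavity of `y − C eʸ` the limit `½ − (C/2)e^L` of `y''` is negative — impossible. The first zero
after a right neighbourhood of `0` on which `y' > 0` does it.) [cite: Hamilton1988, §10]
[cite: MunteanuWang2016, Thm. 1.1] -/
theorem exists_first_zero_deriv_of_profile {C : ℝ} (hC : 0 < C) {Y Y₁ : ℝ → ℝ}
    (hY : ∀ t, HasDerivAt Y (Y₁ t) t) (hY₁ : ∀ t, HasDerivAt Y₁ (1 / 2 - C / 2 * exp (Y t)) t)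
    (hnorm : ∀ t, Y₁ t ^ 2 = Y t - C * exp (Y t)) (h0 : Y₁ 0 = 0)
    (ha : 0 < 1 / 2 - C / 2 * exp (Y 0)) :
    ∃ τ : ℝ, 0 < τ ∧ Y₁ τ = 0 ∧ (∀ t ∈ Ioo 0 τ, 0 < Y₁ t) ∧ Y 0 < Y τ ∧
      1 / 2 - C / 2 * exp (Y τ) < 0 := by
  have hYc : Continuous Y := continuous_iff_continuousAt.2 fun s ↦ (hY s).continuousAt
  have hY₁c : Continuous Y₁ := continuous_iff_continuousAt.2 fun s ↦ (hY₁ s).continuousAt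
  have hderY : ∀ t, deriv Y t = Y₁ t := fun t ↦ (hY t).deriv
  -- (A) `Y₁ > 0` right after `0`
  obtain ⟨ε, hε, hpos⟩ := exists_pos_of_hasDerivAt_pos (hY₁ 0) h0 ha
  -- (B) not for all positive times
  have hnot : ¬ ∀ t, 0 < t → 0 < Y₁ t := by
    intro H
    -- `Y` is monotone on `[0, ∞)` and bounded, hence converges
    have hmono : MonotoneOn Y (Ici 0) :=
      (strictMonoOn_of_deriv_pos (convex_Ici 0) hYc.continuousOn fun x hx ↦ by
        rw [interior_Ici] at hx
        rw [hderY]; exact H x hx).monotoneOn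
    set Z : ℝ → ℝ := fun t ↦ Y (max t 0) with hZ
    have hZm : Monotone Z := fun s t hst ↦
      hmono (le_max_right s 0) (le_max_right t 0) (max_le_max hst le_rfl)
    have hZb : BddAbove (range Z) := ⟨4 / C, by
      rintro _ ⟨t, rfl⟩; exact (pos_and_lt_of_sq_eq hC (hnorm _)).2.le⟩
    set L : ℝ := ⨆ t, Z t with hL
    have hZt : Tendsto Z atTop (𝓝 L) := tendsto_atTop_ciSup hZm hZb
    have hYt : Tendsto Y atTop (𝓝 L) := by
      refine hZt.congr' ?_
      filter_upwards [eventually_ge_atTop 0] with t ht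
      simp [hZ, max_eq_left ht]
    have hY0L : Y 0 < L := by
      have h01 : Y 0 < Y 1 := by
        have hsm := strictMonoOn_of_deriv_pos (convex_Ici 0) hYc.continuousOn fun x hx ↦ by
          rw [interior_Ici] at hx
          rw [hderY]; exact H x hx
        exact hsm (mem_Ici.2 le_rfl) (mem_Ici.2 zero_le_one) zero_lt_one
      have h1L : Y 1 ≤ L := by
        have : Z 1 ≤ L := le_ciSup hZb 1
        simpa [hZ] using this
      linarith
    -- `F(L) ≤ 0`: otherwise `Y₁ ≥ m > 0` eventually and `Y` is unbounded
    have hFL : L - C * exp L ≤ 0 := by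
      by_contra hFpos
      push Not at hFpos
      set m : ℝ := Real.sqrt (L - C * exp L) / 2 with hm
      have hm0 : 0 < m := by positivity
      -- `Y₁² → F(L)`, so eventually `Y₁² > (F L)/4 ≥ ...`, hence `Y₁ > m`
      have hsq : Tendsto (fun t ↦ Y₁ t ^ 2) atTop (𝓝 (L - C * exp L)) := by
        have h := hYt.sub ((continuous_exp.tendsto L).comp hYt |>.const_mul C)
        refine h.congr fun t ↦ ?_
        simp [hnorm t, Function.comp]
      have hev : ∀ᶠ t in atTop, m < Y₁ t := by
        have h4 : (Real.sqrt (L - C * exp L) / 2) ^ 2 < L - C * exp L := by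
          have hs := Real.sq_sqrt hFpos.le
          nlinarith
        filter_upwards [hsq.eventually (lt_mem_nhds h4), eventually_gt_atTop 0] with t ht ht0
        have hpos' := H t ht0
        by_contra hle
        push Not at hle
        have : Y₁ t ^ 2 ≤ m ^ 2 := pow_le_pow_left₀ hpos'.le hle 2
        rw [hm] at this
        linarith
      obtain ⟨t₀, ht₀⟩ := eventually_atTop.mp (hev.and (eventually_gt_atTop 0))
      -- `Y t ≥ Y t₀ + m (t − t₀)` for `t ≥ t₀`
      have hgrow : ∀ t, t₀ ≤ t → Y t₀ + m * (t - t₀) ≤ Y t := by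
        intro t ht
        have hmon : MonotoneOn (fun s ↦ Y s - m * s) (Ici t₀) := by
          refine monotoneOn_of_deriv_nonneg (convex_Ici t₀)
            ((hYc.sub (continuous_const.mul continuous_id)).continuousOn)
            (fun s _ ↦ (((hY s).sub ((hasDerivAt_id s).const_mul m) :
              HasDerivAt (fun s ↦ Y s - m * s) (Y₁ s - m * 1) s)).differentiableAt
              |>.differentiableWithinAt) fun s hs ↦ ?_
          rw [interior_Ici] at hs
          have hd : HasDerivAt (fun s ↦ Y s - m * s) (Y₁ s - m * 1) s :=
            (hY s).sub ((hasDerivAt_id s).const_mul m)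
          rw [hd.deriv]
          have := (ht₀ s (le_of_lt hs)).1
          linarith
        have := hmon (mem_Ici.2 le_rfl) (mem_Ici.2 ht) ht
        simp only at this
        linarith
      have hbig : ∀ᶠ t in atTop, 4 / C < Y t := by
        filter_upwards [eventually_ge_atTop (t₀ + (4 / C - Y t₀) / m + 1),
          eventually_ge_atTop t₀] with t ht ht'
        have h1 := hgrow t ht'
        have h2 : 4 / C - Y t₀ < m * (t - t₀) := by
          have : (4 / C - Y t₀) / m + 1 ≤ t - t₀ := by linarith
          have h3 : (4 / C - Y t₀) / m < t - t₀ := by linarith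
          calc 4 / C - Y t₀ = m * ((4 / C - Y t₀) / m) := by field_simp
            _ < m * (t - t₀) := mul_lt_mul_of_pos_left h3 hm0
        linarith
      obtain ⟨t₁, ht₁⟩ := eventually_atTop.mp hbig
      exact absurd (ht₁ t₁ le_rfl) (not_lt.mpr (pos_and_lt_of_sq_eq hC (hnorm t₁)).2.le)
    -- hence `Φ(L) < 0`, and `Y₁' → Φ(L)` forces `Y₁ → −∞`
    have hΦL : 1 - C * exp L < 0 := by
      have hF0 : Y 0 - C * exp (Y 0) = 0 := by have := hnorm 0; rw [h0] at this; linarith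
      exact one_sub_mul_exp_neg_of_root hC hF0 hFL hY0L
    have hY₁' : Tendsto (fun t ↦ 1 / 2 - C / 2 * exp (Y t)) atTop (𝓝 (1 / 2 - C / 2 * exp L)) :=
      tendsto_const_nhds.sub (((continuous_exp.tendsto L).comp hYt).const_mul (C / 2))
    set m' : ℝ := -(1 / 2 - C / 2 * exp L) / 2 with hm'
    have hm'0 : 0 < m' := by rw [hm']; linarith
    have hev' : ∀ᶠ t in atTop, 1 / 2 - C / 2 * exp (Y t) < -m' :=
      hY₁'.eventually (gt_mem_nhds (by rw [hm']; linarith))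
    obtain ⟨t₀, ht₀⟩ := eventually_atTop.mp (hev'.and (eventually_gt_atTop 0))
    have hdec : ∀ t, t₀ ≤ t → Y₁ t ≤ Y₁ t₀ - m' * (t - t₀) := by
      intro t ht
      have hanti : AntitoneOn (fun s ↦ Y₁ s + m' * s) (Ici t₀) := by
        refine antitoneOn_of_deriv_nonpos (convex_Ici t₀)
          ((hY₁c.add (continuous_const.mul continuous_id)).continuousOn)
          (fun s _ ↦ (((hY₁ s).add ((hasDerivAt_id s).const_mul m') :
            HasDerivAt (fun s ↦ Y₁ s + m' * s) (1 / 2 - C / 2 * exp (Y s) + m' * 1) s)).differentiableAt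
            |>.differentiableWithinAt) fun s hs ↦ ?_
        rw [interior_Ici] at hs
        have hd : HasDerivAt (fun s ↦ Y₁ s + m' * s) (1 / 2 - C / 2 * exp (Y s) + m' * 1) s :=
          (hY₁ s).add ((hasDerivAt_id s).const_mul m')
        rw [hd.deriv]
        have := (ht₀ s (le_of_lt hs)).1
        linarith
      have := hanti (mem_Ici.2 le_rfl) (mem_Ici.2 ht) ht
      simp only at this
      linarith
    have ht₁ : t₀ ≤ t₀ + Y₁ t₀ / m' + 1 := by
      have := (H t₀ (ht₀ t₀ le_rfl).2).le
      have : 0 ≤ Y₁ t₀ / m' := div_nonneg this hm'0.le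
      linarith
    have h1 := hdec (t₀ + Y₁ t₀ / m' + 1) ht₁
    have h2 : Y₁ t₀ - m' * (t₀ + Y₁ t₀ / m' + 1 - t₀) = -m' := by field_simp; ring
    rw [h2] at h1
    have h3 := H (t₀ + Y₁ t₀ / m' + 1) (by linarith [(ht₀ t₀ le_rfl).2])
    linarith
  -- (C) the first zero of `Y₁` after `ε/2`
  push Not at hnot
  obtain ⟨t₁, ht₁, hY₁t₁⟩ := hnot
  have hεt₁ : ε ≤ t₁ := by
    by_contra h
    push Not at h
    exact absurd (hpos t₁ ⟨ht₁, h⟩) (not_lt.mpr hY₁t₁)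
  set Zs : Set ℝ := {t | ε / 2 ≤ t ∧ Y₁ t = 0} with hZs
  have hZsc : IsClosed Zs := (isClosed_le continuous_const continuous_id).inter
    (isClosed_eq hY₁c continuous_const)
  have hZsb : BddBelow Zs := ⟨ε / 2, fun t ht ↦ ht.1⟩
  have hZsn : Zs.Nonempty := by
    have hivt := intermediate_value_Icc' (show ε / 2 ≤ t₁ by linarith) hY₁c.continuousOn
      (f := Y₁) (a := ε / 2) (b := t₁)
    have h0mem : (0 : ℝ) ∈ Icc (Y₁ t₁) (Y₁ (ε / 2)) := ⟨hY₁t₁, (hpos _ ⟨by linarith, by linarith⟩).le⟩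
    obtain ⟨c, hc, hc0⟩ := hivt h0mem
    exact ⟨c, hc.1, hc0⟩
  set τ : ℝ := sInf Zs with hτ
  have hτmem : τ ∈ Zs := hZsc.csInf_mem hZsn hZsb
  have hτpos : 0 < τ := by linarith [hτmem.1]
  have hbefore : ∀ t ∈ Ioo 0 τ, 0 < Y₁ t := by
    intro t ht
    by_cases htε : t < ε
    · exact hpos t ⟨ht.1, htε⟩
    · push Not at htε
      by_contra hle
      push Not at hle
      -- a zero of `Y₁` in `[ε/2, t]`, before `τ`
      have hivt := intermediate_value_Icc' (show ε / 2 ≤ t by linarith) hY₁c.continuousOn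
        (f := Y₁) (a := ε / 2) (b := t)
      have h0mem : (0 : ℝ) ∈ Icc (Y₁ t) (Y₁ (ε / 2)) := ⟨hle, (hpos _ ⟨by linarith, by linarith⟩).le⟩
      obtain ⟨c, hc, hc0⟩ := hivt h0mem
      have hcZ : c ∈ Zs := ⟨hc.1, hc0⟩
      have := csInf_le hZsb hcZ
      linarith [hc.2, ht.2]
  -- (D) `Y 0 < Y τ`
  have hsm : StrictMonoOn Y (Icc 0 τ) :=
    strictMonoOn_of_deriv_pos (convex_Icc 0 τ) hYc.continuousOn fun x hx ↦ by
      rw [interior_Icc] at hx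
      rw [hderY]; exact hbefore x hx
  have hY0τ : Y 0 < Y τ := hsm ⟨le_rfl, hτpos.le⟩ ⟨hτpos.le, le_rfl⟩ hτpos
  -- (E) `Φ(Y τ) < 0`
  have hF0 : Y 0 - C * exp (Y 0) = 0 := by have := hnorm 0; rw [h0] at this; linarith
  have hFτ : Y τ - C * exp (Y τ) ≤ 0 := by have := hnorm τ; rw [hτmem.2] at this; linarith
  have hneg := one_sub_mul_exp_neg_of_root hC hF0 hFτ hY0τ
  exact ⟨τ, hτpos, hτmem.2, hbefore, hY0τ, by linarith⟩


/-! ### The normal Jacobi field is `y'/y''(0)` -/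

/-- **`j = y'/a`, `a = y''(0)`**: along the profile `y'' = ½ − (C/2)eʸ` with `y'(0) = 0`, the
solution of the Jacobi equation `j'' = −(C/2) e^{y} j`, `j(0) = 0`, `j'(0) = 1` is `y'/a` (both solve
the same linear equation with the same data, since `(y')'' = −(C/2)eʸ y'`); in particular `j`
vanishes exactly where `y'` does, and `j' = y''/a`. [cite: Hamilton1988, §10]
[cite: MunteanuWang2016, Thm. 1.1] -/
theorem jacobi_eq_deriv_div {C a : ℝ} {Y Y₁ j j₁ : ℝ → ℝ} (hY : ∀ t, HasDerivAt Y (Y₁ t) t)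
    (hY₁ : ∀ t, HasDerivAt Y₁ (1 / 2 - C / 2 * exp (Y t)) t) (h0 : Y₁ 0 = 0)
    (ha : a = 1 / 2 - C / 2 * exp (Y 0)) (ha0 : a ≠ 0)
    (hj : ∀ t, HasDerivAt j (j₁ t) t) (hj₁ : ∀ t, HasDerivAt j₁ (-(C / 2 * exp (Y t)) * j t) t)
    (hj0 : j 0 = 0) (hj₁0 : j₁ 0 = 1) (t : ℝ) :
    j t = Y₁ t / a ∧ j₁ t = (1 / 2 - C / 2 * exp (Y t)) / a := by
  have hk : Continuous fun t ↦ C / 2 * exp (Y t) :=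
    continuous_const.mul (continuous_exp.comp
      (continuous_iff_continuousAt.2 fun s ↦ (hY s).continuousAt))
  have hu : ∀ t, HasDerivAt (fun t ↦ Y₁ t / a) ((1 / 2 - C / 2 * exp (Y t)) / a) t := fun t ↦
    (hY₁ t).div_const a
  have hu₁ : ∀ t, HasDerivAt (fun t ↦ (1 / 2 - C / 2 * exp (Y t)) / a)
      (-(C / 2 * exp (Y t)) * (Y₁ t / a)) t := fun t ↦ by
    have h := (((Real.hasDerivAt_exp (Y t)).comp t (hY t)).const_mul (C / 2)).const_sub (1 / 2)
      |>.div_const a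
    refine h.congr_deriv ?_
    ring
  have hjt : ∀ t, j t = Y₁ t / a := fun t ↦
    eq_of_hasDerivAt_two_linear hk hj hj₁ hu hu₁ (by rw [hj0, h0, zero_div])
      (by rw [hj₁0, ← ha, div_self ha0]) t
  refine ⟨hjt t, ?_⟩
  have h1 : deriv j t = j₁ t := (hj t).deriv
  have h2 : deriv j t = (1 / 2 - C / 2 * exp (Y t)) / a := by
    rw [show j = fun t ↦ Y₁ t / a from funext hjt]
    exact (hu t).deriv
  rw [← h1, h2]

/-! ### A closed unit planar curve of constant speed, injective on a period, has speed one -/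

/-- **Rotation number one.** Let `(α, β) : ℝ → ℝ²` be `C¹` with `α² + β² = 1` and constant speed
`α'² + β'² = c²`, `c > 0`; suppose `(α, β)(2π) = (α, β)(0)` and `(α, β)(s) ≠ (α, β)(0)` for
`0 < s < 2π`. Then `c = 1`. (The angular velocity `αβ' − βα'` has square `c²`, hence is `± c`
identically; so the curve is a uniform rotation `s ↦ R(±cs)(α₀, β₀)`; closing at `2π` gives
`c ∈ ℤ`, and injectivity before `2π` excludes `c ≥ 2`.) [folklore] -/
theorem rotation_number_eq_one {α β α₁ β₁ : ℝ → ℝ} {c : ℝ} (hc : 0 < c)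
    (hα : ∀ s, HasDerivAt α (α₁ s) s) (hβ : ∀ s, HasDerivAt β (β₁ s) s)
    (hα₁ : Continuous α₁) (hβ₁ : Continuous β₁)
    (hunit : ∀ s, α s ^ 2 + β s ^ 2 = 1) (hspeed : ∀ s, α₁ s ^ 2 + β₁ s ^ 2 = c ^ 2)
    (hper : α (2 * π) = α 0 ∧ β (2 * π) = β 0)
    (hinj : ∀ s ∈ Ioo 0 (2 * π), (α s, β s) ≠ (α 0, β 0)) : c = 1 := by
  have hαc : Continuous α := continuous_iff_continuousAt.2 fun s ↦ (hα s).continuousAt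
  have hβc : Continuous β := continuous_iff_continuousAt.2 fun s ↦ (hβ s).continuousAt
  -- (i) `α α' + β β' = 0`
  have horth : ∀ s, α s * α₁ s + β s * β₁ s = 0 := by
    intro s
    have h1 : HasDerivAt (fun s ↦ α s ^ 2 + β s ^ 2) (2 * α s * α₁ s + 2 * β s * β₁ s) s := by
      have := ((hα s).pow 2).add ((hβ s).pow 2)
      refine this.congr_deriv ?_
      push_cast
      ring
    have h2 : HasDerivAt (fun s ↦ α s ^ 2 + β s ^ 2) 0 s := by
      have : (fun s ↦ α s ^ 2 + β s ^ 2) = fun _ ↦ (1 : ℝ) := funext hunit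
      rw [this]; exact hasDerivAt_const s 1
    have := h1.unique h2
    linarith
  -- (ii) the angular velocity `ω = αβ' − βα'` has `ω² = c²`, so `ω = ε c`
  set ω : ℝ → ℝ := fun s ↦ α s * β₁ s - β s * α₁ s with hω
  have hωsq : ∀ s, ω s ^ 2 = c ^ 2 := fun s ↦ by
    have h := hunit s; have h' := hspeed s; have h'' := horth s
    simp only [hω]
    nlinarith [h, h', h'']
  have hωc : Continuous ω := (hαc.mul hβ₁).sub (hβc.mul hα₁)
  obtain ⟨ε, hε, hωε⟩ : ∃ ε : ℝ, ε ^ 2 = 1 ∧ ∀ s, ω s = ε * c := by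
    have h := isPreconnected_univ.eq_or_eq_neg_of_sq_eq (f := ω) (g := fun _ ↦ c)
      hωc.continuousOn continuousOn_const (fun s _ ↦ by simpa using hωsq s)
      (fun _ ↦ hc.ne')
    rcases h with h | h
    · exact ⟨1, by norm_num, fun s ↦ by simpa using h (mem_univ s)⟩
    · exact ⟨-1, by norm_num, fun s ↦ by simpa using h (mem_univ s)⟩
  -- (iii) the rotation equations `α' = −εc β`, `β' = εc α`
  have hα₁eq : ∀ s, α₁ s = -(ε * c) * β s := fun s ↦ by
    have h := hunit s; have h' := horth s; have h'' := hωε s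
    simp only [hω] at h''
    linear_combination (-(α₁ s)) * h + (α s) * h' - (β s) * h''
  have hβ₁eq : ∀ s, β₁ s = (ε * c) * α s := fun s ↦ by
    have h := hunit s; have h' := horth s; have h'' := hωε s
    simp only [hω] at h''
    linear_combination (-(β₁ s)) * h + (β s) * h' + (α s) * h''
  -- (iv) the solution is the uniform rotation of the initial point
  set θ : ℝ := ε * c with hθ
  set A : ℝ → ℝ := fun s ↦ α 0 * cos (θ * s) - β 0 * sin (θ * s) with hA
  set B : ℝ → ℝ := fun s ↦ α 0 * sin (θ * s) + β 0 * cos (θ * s) with hB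
  have hAd : ∀ s, HasDerivAt A (-θ * B s) s := fun s ↦ by
    have h1 := ((hasDerivAt_id s).const_mul θ).cos.const_mul (α 0)
    have h2 := ((hasDerivAt_id s).const_mul θ).sin.const_mul (β 0)
    have h := h1.sub h2
    refine h.congr_deriv ?_
    simp only [hB, id_eq, mul_one]
    ring
  have hBd : ∀ s, HasDerivAt B (θ * A s) s := fun s ↦ by
    have h1 := ((hasDerivAt_id s).const_mul θ).sin.const_mul (α 0)
    have h2 := ((hasDerivAt_id s).const_mul θ).cos.const_mul (β 0)
    have h := h1.add h2
    refine h.congr_deriv ?_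
    simp only [hA, id_eq, mul_one]
    ring
  have hrot : ∀ s, α s = A s ∧ β s = B s := by
    -- `D = (α − A)² + (β − B)²` has zero derivative and vanishes at `0`
    have hD : ∀ s, HasDerivAt (fun s ↦ (α s - A s) ^ 2 + (β s - B s) ^ 2) 0 s := fun s ↦ by
      have h := (((hα s).sub (hAd s)).pow 2).add (((hβ s).sub (hBd s)).pow 2)
      refine h.congr_deriv ?_
      simp only [Pi.sub_apply, hα₁eq s, hβ₁eq s]
      push_cast
      ring
    have hconst := is_const_of_deriv_eq_zero (f := fun s ↦ (α s - A s) ^ 2 + (β s - B s) ^ 2)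
      (fun s ↦ (hD s).differentiableAt) (fun s ↦ (hD s).deriv)
    intro s
    have h := hconst s 0
    have h0 : (α 0 - A 0) ^ 2 + (β 0 - B 0) ^ 2 = 0 := by simp [hA, hB]
    rw [h0] at h
    have h1 : (α s - A s) ^ 2 = 0 := by nlinarith [sq_nonneg (α s - A s), sq_nonneg (β s - B s)]
    have h2 : (β s - B s) ^ 2 = 0 := by nlinarith [sq_nonneg (α s - A s), sq_nonneg (β s - B s)]
    exact ⟨by simpa [sub_eq_zero] using h1, by simpa [sub_eq_zero] using h2⟩
  -- (v) closing at `2π`: `cos (2π c) = 1`, so `c` is a positive integer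
  have hcos : cos (θ * (2 * π)) = 1 := by
    have h1 := (hrot (2 * π)).1
    have h2 := (hrot (2 * π)).2
    rw [hper.1] at h1
    rw [hper.2] at h2
    simp only [hA, hB] at h1 h2
    have hu := hunit 0
    nlinarith [hu, h1, h2, sin_sq_add_cos_sq (θ * (2 * π))]
  obtain ⟨n, hn⟩ := (cos_eq_one_iff _).mp hcos
  have hθn : θ = n := by
    have : (n : ℝ) * (2 * π) = θ * (2 * π) := hn
    field_simp at this
    linarith
  have hcn : c = |(n : ℝ)| := by
    have h1 : θ ^ 2 = c ^ 2 := by rw [hθ, mul_pow, hε, one_mul]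
    rw [hθn] at h1
    rw [← Real.sqrt_sq hc.le, ← h1, Real.sqrt_sq_eq_abs]
  -- (vi) injectivity on `(0, 2π)` excludes `|n| ≥ 2`
  have hn0 : n ≠ 0 := by
    rintro rfl
    simp at hcn
    exact hc.ne' hcn
  by_contra hc1
  have hn2 : 2 ≤ |(n : ℝ)| := by
    have h1 : (1 : ℝ) ≤ |(n : ℝ)| := by
      rw [← Int.cast_abs]; exact_mod_cast Int.one_le_abs hn0
    have hne : |(n : ℝ)| ≠ 1 := fun h ↦ hc1 (hcn.trans h)
    have hint : ∃ m : ℤ, |(n : ℝ)| = m := ⟨|n|, by push_cast; rfl⟩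
    obtain ⟨m, hm⟩ := hint
    rw [hm] at h1 hne ⊢
    have : (1 : ℤ) ≤ m := by exact_mod_cast h1
    have : m ≠ 1 := fun h ↦ hne (by rw [h]; simp)
    have : (2 : ℤ) ≤ m := by omega
    exact_mod_cast this
  set s₀ : ℝ := 2 * π / |(n : ℝ)| with hs₀
  have hnpos : 0 < |(n : ℝ)| := by linarith
  have hs₀I : s₀ ∈ Ioo 0 (2 * π) := by
    refine ⟨by positivity, ?_⟩
    rw [hs₀, div_lt_iff₀ hnpos]
    nlinarith [pi_pos]
  apply hinj s₀ hs₀I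
  -- at `s₀` the rotation angle is `θ s₀ = ± 2π`
  have hn0' : (n : ℝ) ≠ 0 := by exact_mod_cast hn0
  have hang : ∃ k : ℤ, θ * s₀ = k * (2 * π) := by
    rcases abs_choice (n : ℝ) with h | h
    · refine ⟨1, ?_⟩
      rw [hθn, hs₀, h, Int.cast_one, one_mul, mul_div_assoc', mul_div_right_comm, div_self hn0',
        one_mul]
    · refine ⟨-1, ?_⟩
      rw [hθn, hs₀, h, Int.cast_neg, Int.cast_one, div_neg, mul_neg, mul_div_assoc',
        mul_div_right_comm, div_self hn0', one_mul, neg_one_mul]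
  obtain ⟨k, hk⟩ := hang
  have hcos0 : cos (θ * s₀) = 1 := by rw [hk]; exact (cos_eq_one_iff _).mpr ⟨k, rfl⟩
  have hsin0 : sin (θ * s₀) = 0 := by
    rw [hk]; exact sin_eq_zero_iff.mpr ⟨2 * k, by push_cast; ring⟩
  have h1 := (hrot s₀).1
  have h2 := (hrot s₀).2
  simp only [hA, hB, hcos0, hsin0, mul_one, mul_zero, sub_zero, zero_add] at h1 h2
  rw [h1, h2]

/-! ### The two critical values cannot be symmetric about `1` -/

/-- `2d < log ((1 + d)/(1 − d))` for `0 < d < 1` (the function `log(1+u) − log(1−u) − 2u` has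
derivative `2u²/(1 − u²) > 0`). [folklore] -/
theorem two_mul_lt_log_div {d : ℝ} (hd0 : 0 < d) (hd1 : d < 1) :
    2 * d < Real.log ((1 + d) / (1 - d)) := by
  set G : ℝ → ℝ := fun u ↦ Real.log (1 + u) - Real.log (1 - u) - 2 * u with hG
  have hGd : ∀ u ∈ Ioo (-1 : ℝ) 1, HasDerivAt G (1 / (1 + u) + 1 / (1 - u) - 2) u := by
    intro u hu
    have h1 : HasDerivAt (fun u ↦ Real.log (1 + u)) (1 / (1 + u)) u := by
      have := ((hasDerivAt_id u).const_add 1).log (by simp only [id_eq]; linarith [hu.1])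
      simpa using this
    have h2 : HasDerivAt (fun u ↦ Real.log (1 - u)) (-1 / (1 - u)) u := by
      have := ((hasDerivAt_id u).const_sub 1).log (by simp only [id_eq]; linarith [hu.2])
      simpa [neg_div] using this
    have h := (h1.sub h2).sub ((hasDerivAt_id u).const_mul 2)
    refine h.congr_deriv ?_
    simp only [mul_one]
    ring
  have hmono : StrictMonoOn G (Ico 0 1) := by
    refine strictMonoOn_of_deriv_pos (convex_Ico 0 1) ?_ fun u hu ↦ ?_
    · exact HasDerivAt.continuousOn fun u hu ↦ hGd u ⟨by linarith [hu.1], hu.2⟩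
    · rw [interior_Ico] at hu
      rw [(hGd u ⟨by linarith [hu.1], hu.2⟩).deriv]
      have h1 : 0 < 1 + u := by linarith [hu.1]
      have h2 : 0 < 1 - u := by linarith [hu.2]
      rw [div_add_div _ _ h1.ne' h2.ne', sub_pos, lt_div_iff₀ (mul_pos h1 h2)]
      nlinarith [hu.1]
  have h := hmono (show (0 : ℝ) ∈ Ico 0 1 from ⟨le_rfl, zero_lt_one⟩) ⟨hd0.le, hd1⟩ hd0
  simp only [hG, add_zero, sub_zero, Real.log_one, mul_zero, sub_self] at h
  rw [Real.log_div (by linarith) (by linarith)]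
  linarith

/-- **`x = C eˣ`, `y = C eʸ` and `x + y = 2` force `x = y`.** (Then `C > 0`, `x, y ∈ (0, 2)`;
with `x = 1 − d`, `y = 1 + d`: `log(1+d) − log(1−d) = y − x = 2d`, contradicting
`two_mul_lt_log_div` unless `d = 0`.) This excludes a pair of critical values of the potential of
a normalised two-dimensional shrinker placed symmetrically about `1`. [cite: Hamilton1988, §10]
[cite: MunteanuWang2016, Thm. 1.1] -/
theorem eq_of_eq_mul_exp_of_add_eq_two {C x y : ℝ} (hx : x = C * exp x) (hy : y = C * exp y)
    (hsum : x + y = 2) : x = y := by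
  -- `C > 0`, `x, y > 0`
  have hC : 0 < C := by
    by_contra hC
    push Not at hC
    have h1 : x ≤ 0 := by rw [hx]; exact mul_nonpos_of_nonpos_of_nonneg hC (exp_pos x).le
    have h2 : y ≤ 0 := by rw [hy]; exact mul_nonpos_of_nonpos_of_nonneg hC (exp_pos y).le
    linarith
  have hx0 : 0 < x := by rw [hx]; exact mul_pos hC (exp_pos x)
  have hy0 : 0 < y := by rw [hy]; exact mul_pos hC (exp_pos y)
  -- `log x − x = log C = log y − y`
  have hlx : Real.log x = Real.log C + x := by
    conv_lhs => rw [hx]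
    rw [Real.log_mul hC.ne' (exp_pos x).ne', Real.log_exp]
  have hly : Real.log y = Real.log C + y := by
    conv_lhs => rw [hy]
    rw [Real.log_mul hC.ne' (exp_pos y).ne', Real.log_exp]
  -- symmetric roles: assume `x ≤ y`
  wlog hxy : x ≤ y generalizing x y
  · exact (this hy hx (by linarith) hy0 hx0 hly hlx (le_of_not_ge hxy)).symm
  set d : ℝ := (y - x) / 2 with hd
  have hd0 : 0 ≤ d := by rw [hd]; linarith
  have hd1 : d < 1 := by rw [hd]; linarith
  have hxd : x = 1 - d := by rw [hd]; linarith
  have hyd : y = 1 + d := by rw [hd]; linarith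
  rcases hd0.eq_or_lt with hdz | hdpos
  · linarith [hxd, hyd, hdz]
  · exfalso
    have hlog : Real.log ((1 + d) / (1 - d)) = 2 * d := by
      rw [Real.log_div (by linarith) (by linarith), ← hyd, ← hxd, hly, hlx, hd]
      ring
    have := two_mul_lt_log_div hdpos hd1
    linarith

/-! ### The mirror case `y''(0) < 0`: the first zero of `y'` going down -/

/-- For `F(y) = y − C eʸ` (`C > 0`): if `F(x₀) = 0`, `F(x₁) ≤ 0` and `x₁ < x₀` then
`F'(x₁) = 1 − C e^{x₁} > 0` (mean value theorem and strict monotonicity of `F'`). [folklore] -/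
theorem one_sub_mul_exp_pos_of_root {C x₀ x₁ : ℝ} (hC : 0 < C) (h0 : x₀ - C * exp x₀ = 0)
    (h1 : x₁ - C * exp x₁ ≤ 0) (hlt : x₁ < x₀) : 0 < 1 - C * exp x₁ := by
  have hF : ∀ x, HasDerivAt (fun y ↦ y - C * exp y) (1 - C * exp x) x := fun x ↦
    (hasDerivAt_id x).sub ((Real.hasDerivAt_exp x).const_mul C)
  obtain ⟨ξ, hξ, hξ'⟩ := exists_hasDerivAt_eq_slope (fun y ↦ y - C * exp y)
    (fun x ↦ 1 - C * exp x) hlt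
    (HasDerivAt.continuousOn fun x _ ↦ hF x) (fun x _ ↦ hF x)
  have hslope : 0 ≤ (x₀ - C * exp x₀ - (x₁ - C * exp x₁)) / (x₀ - x₁) :=
    div_nonneg (by linarith) (by linarith)
  have hξle : 0 ≤ 1 - C * exp ξ := hξ' ▸ hslope
  have hexp : exp x₁ < exp ξ := exp_lt_exp.mpr hξ.1
  nlinarith [mul_lt_mul_of_pos_left hexp hC]

/-- **The profile started at a critical point with `y''(0) < 0` decreases to a first critical
time.** Mirror image of `exists_first_zero_deriv_of_profile`: for `y'' = ½ − (C/2) eʸ` with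
`y'² = y − C eʸ`, `y'(0) = 0`, `y''(0) < 0`, there is a first `τ > 0` with `y'(τ) = 0`; `y' < 0`
on `(0, τ)`, `y(τ) < y(0)` and `y''(τ) = ½ − (C/2)e^{y(τ)} > 0`. (`y` is decreasing and
positive while `y' < 0`; it cannot decrease for ever, since its limit `L` would satisfy
`F(L) ≤ 0`, forcing `Φ(L) > 0` and `y' → +∞`.) [cite: Hamilton1988, §10]
[cite: MunteanuWang2016, Thm. 1.1] -/
theorem exists_first_zero_deriv_of_profile_neg {C : ℝ} (hC : 0 < C) {Y Y₁ : ℝ → ℝ}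
    (hY : ∀ t, HasDerivAt Y (Y₁ t) t) (hY₁ : ∀ t, HasDerivAt Y₁ (1 / 2 - C / 2 * exp (Y t)) t)
    (hnorm : ∀ t, Y₁ t ^ 2 = Y t - C * exp (Y t)) (h0 : Y₁ 0 = 0)
    (ha : 1 / 2 - C / 2 * exp (Y 0) < 0) :
    ∃ τ : ℝ, 0 < τ ∧ Y₁ τ = 0 ∧ (∀ t ∈ Ioo 0 τ, Y₁ t < 0) ∧ Y τ < Y 0 ∧
      0 < 1 / 2 - C / 2 * exp (Y τ) := by
  have hYc : Continuous Y := continuous_iff_continuousAt.2 fun s ↦ (hY s).continuousAt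
  have hY₁c : Continuous Y₁ := continuous_iff_continuousAt.2 fun s ↦ (hY₁ s).continuousAt
  have hderY : ∀ t, deriv Y t = Y₁ t := fun t ↦ (hY t).deriv
  -- (A) `Y₁ < 0` right after `0`
  obtain ⟨ε, hε, hneg⟩ : ∃ ε : ℝ, 0 < ε ∧ ∀ t ∈ Ioo 0 ε, Y₁ t < 0 := by
    obtain ⟨ε, hε, hpos⟩ := exists_pos_of_hasDerivAt_pos (hY₁ 0).neg (by simp [h0])
      (by linarith)
    exact ⟨ε, hε, fun t ht ↦ by have := hpos t ht; simp only [Pi.neg_apply] at this; linarith⟩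
  -- (B) not for all positive times
  have hnot : ¬ ∀ t, 0 < t → Y₁ t < 0 := by
    intro H
    -- `Y` is antitone on `[0, ∞)` and bounded below, hence converges
    have hanti : AntitoneOn Y (Ici 0) :=
      (strictAntiOn_of_deriv_neg (convex_Ici 0) hYc.continuousOn fun x hx ↦ by
        rw [interior_Ici] at hx
        rw [hderY]; exact H x hx).antitoneOn
    set Z : ℝ → ℝ := fun t ↦ Y (max t 0) with hZ
    have hZm : Antitone Z := fun s t hst ↦
      hanti (le_max_right s 0) (le_max_right t 0) (max_le_max hst le_rfl)
    have hZb : BddBelow (range Z) := ⟨0, by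
      rintro _ ⟨t, rfl⟩; exact (pos_and_lt_of_sq_eq hC (hnorm _)).1.le⟩
    set L : ℝ := ⨅ t, Z t with hL
    have hZt : Tendsto Z atTop (𝓝 L) := tendsto_atTop_ciInf hZm hZb
    have hYt : Tendsto Y atTop (𝓝 L) := by
      refine hZt.congr' ?_
      filter_upwards [eventually_ge_atTop 0] with t ht
      simp [hZ, max_eq_left ht]
    have hLY0 : L < Y 0 := by
      have h01 : Y 1 < Y 0 := by
        have hsm := strictAntiOn_of_deriv_neg (convex_Ici 0) hYc.continuousOn fun x hx ↦ by
          rw [interior_Ici] at hx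
          rw [hderY]; exact H x hx
        exact hsm (mem_Ici.2 le_rfl) (mem_Ici.2 zero_le_one) zero_lt_one
      have h1L : L ≤ Y 1 := by
        have : L ≤ Z 1 := ciInf_le hZb 1
        simpa [hZ] using this
      linarith
    -- `F(L) ≤ 0`: otherwise `Y₁ ≤ -m < 0` eventually and `Y → -∞`
    have hFL : L - C * exp L ≤ 0 := by
      by_contra hFpos
      push Not at hFpos
      set m : ℝ := Real.sqrt (L - C * exp L) / 2 with hm
      have hm0 : 0 < m := by positivity
      have hsq : Tendsto (fun t ↦ Y₁ t ^ 2) atTop (𝓝 (L - C * exp L)) := by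
        have h := hYt.sub ((continuous_exp.tendsto L).comp hYt |>.const_mul C)
        refine h.congr fun t ↦ ?_
        simp [hnorm t, Function.comp]
      have hev : ∀ᶠ t in atTop, Y₁ t < -m := by
        have h4 : (Real.sqrt (L - C * exp L) / 2) ^ 2 < L - C * exp L := by
          have hs := Real.sq_sqrt hFpos.le
          nlinarith
        filter_upwards [hsq.eventually (lt_mem_nhds h4), eventually_gt_atTop 0] with t ht ht0
        have hneg' := H t ht0
        by_contra hle
        push Not at hle
        have : Y₁ t ^ 2 ≤ m ^ 2 := by
          rw [← neg_sq (Y₁ t)]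
          exact pow_le_pow_left₀ (by linarith) (by linarith) 2
        rw [hm] at this
        linarith
      obtain ⟨t₀, ht₀⟩ := eventually_atTop.mp (hev.and (eventually_gt_atTop 0))
      -- `Y t ≤ Y t₀ - m (t − t₀)` for `t ≥ t₀`
      have hdecay : ∀ t, t₀ ≤ t → Y t ≤ Y t₀ - m * (t - t₀) := by
        intro t ht
        have hanti' : AntitoneOn (fun s ↦ Y s + m * s) (Ici t₀) := by
          refine antitoneOn_of_deriv_nonpos (convex_Ici t₀)
            ((hYc.add (continuous_const.mul continuous_id)).continuousOn)
            (fun s _ ↦ (((hY s).add ((hasDerivAt_id s).const_mul m) :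
              HasDerivAt (fun s ↦ Y s + m * s) (Y₁ s + m * 1) s)).differentiableAt
              |>.differentiableWithinAt) fun s hs ↦ ?_
          rw [interior_Ici] at hs
          have hd : HasDerivAt (fun s ↦ Y s + m * s) (Y₁ s + m * 1) s :=
            (hY s).add ((hasDerivAt_id s).const_mul m)
          rw [hd.deriv]
          have := (ht₀ s (le_of_lt hs)).1
          linarith
        have := hanti' (mem_Ici.2 le_rfl) (mem_Ici.2 ht) ht
        simp only at this
        linarith
      have hsmall : ∀ᶠ t in atTop, Y t < 0 := by
        filter_upwards [eventually_ge_atTop (t₀ + Y t₀ / m + 1), eventually_ge_atTop t₀]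
          with t ht ht'
        have h1 := hdecay t ht'
        have h2 : Y t₀ < m * (t - t₀) := by
          have h3 : Y t₀ / m < t - t₀ := by linarith
          calc Y t₀ = m * (Y t₀ / m) := by field_simp
            _ < m * (t - t₀) := mul_lt_mul_of_pos_left h3 hm0
        linarith
      obtain ⟨t₁, ht₁⟩ := eventually_atTop.mp hsmall
      exact absurd (ht₁ t₁ le_rfl) (not_lt.mpr (pos_and_lt_of_sq_eq hC (hnorm t₁)).1.le)
    -- hence `Φ(L) > 0`, and `Y₁' → Φ(L)` forces `Y₁ → +∞`
    have hΦL : 0 < 1 - C * exp L := by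
      have hF0 : Y 0 - C * exp (Y 0) = 0 := by have := hnorm 0; rw [h0] at this; linarith
      exact one_sub_mul_exp_pos_of_root hC hF0 hFL hLY0
    have hY₁' : Tendsto (fun t ↦ 1 / 2 - C / 2 * exp (Y t)) atTop (𝓝 (1 / 2 - C / 2 * exp L)) :=
      tendsto_const_nhds.sub (((continuous_exp.tendsto L).comp hYt).const_mul (C / 2))
    set m' : ℝ := (1 / 2 - C / 2 * exp L) / 2 with hm'
    have hm'0 : 0 < m' := by rw [hm']; linarith
    have hev' : ∀ᶠ t in atTop, m' < 1 / 2 - C / 2 * exp (Y t) :=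
      hY₁'.eventually (lt_mem_nhds (by rw [hm']; linarith))
    obtain ⟨t₀, ht₀⟩ := eventually_atTop.mp (hev'.and (eventually_gt_atTop 0))
    have hinc : ∀ t, t₀ ≤ t → Y₁ t₀ + m' * (t - t₀) ≤ Y₁ t := by
      intro t ht
      have hmono : MonotoneOn (fun s ↦ Y₁ s - m' * s) (Ici t₀) := by
        refine monotoneOn_of_deriv_nonneg (convex_Ici t₀)
          ((hY₁c.sub (continuous_const.mul continuous_id)).continuousOn)
          (fun s _ ↦ (((hY₁ s).sub ((hasDerivAt_id s).const_mul m') :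
            HasDerivAt (fun s ↦ Y₁ s - m' * s) (1 / 2 - C / 2 * exp (Y s) - m' * 1)
              s)).differentiableAt |>.differentiableWithinAt) fun s hs ↦ ?_
        rw [interior_Ici] at hs
        have hd : HasDerivAt (fun s ↦ Y₁ s - m' * s) (1 / 2 - C / 2 * exp (Y s) - m' * 1) s :=
          (hY₁ s).sub ((hasDerivAt_id s).const_mul m')
        rw [hd.deriv]
        have := (ht₀ s (le_of_lt hs)).1
        linarith
      have := hmono (mem_Ici.2 le_rfl) (mem_Ici.2 ht) ht
      simp only at this
      linarith
    have ht₁ : t₀ ≤ t₀ + (-Y₁ t₀) / m' + 1 := by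
      have := (H t₀ (ht₀ t₀ le_rfl).2).le
      have : 0 ≤ -Y₁ t₀ / m' := div_nonneg (by linarith) hm'0.le
      linarith
    have h1 := hinc (t₀ + (-Y₁ t₀) / m' + 1) ht₁
    have h2 : Y₁ t₀ + m' * (t₀ + (-Y₁ t₀) / m' + 1 - t₀) = m' := by field_simp; ring
    rw [h2] at h1
    have h3 := H (t₀ + (-Y₁ t₀) / m' + 1) (by linarith [(ht₀ t₀ le_rfl).2])
    linarith
  -- (C) the first zero of `Y₁` after `ε/2`
  push Not at hnot
  obtain ⟨t₁, ht₁, hY₁t₁⟩ := hnot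
  have hεt₁ : ε ≤ t₁ := by
    by_contra h
    push Not at h
    exact absurd (hneg t₁ ⟨ht₁, h⟩) (not_lt.mpr hY₁t₁)
  set Zs : Set ℝ := {t | ε / 2 ≤ t ∧ Y₁ t = 0} with hZs
  have hZsc : IsClosed Zs := (isClosed_le continuous_const continuous_id).inter
    (isClosed_eq hY₁c continuous_const)
  have hZsb : BddBelow Zs := ⟨ε / 2, fun t ht ↦ ht.1⟩
  have hZsn : Zs.Nonempty := by
    have hivt := intermediate_value_Icc (show ε / 2 ≤ t₁ by linarith) hY₁c.continuousOn
      (f := Y₁) (a := ε / 2) (b := t₁)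
    have h0mem : (0 : ℝ) ∈ Icc (Y₁ (ε / 2)) (Y₁ t₁) :=
      ⟨(hneg _ ⟨by linarith, by linarith⟩).le, hY₁t₁⟩
    obtain ⟨c, hc, hc0⟩ := hivt h0mem
    exact ⟨c, hc.1, hc0⟩
  set τ : ℝ := sInf Zs with hτ
  have hτmem : τ ∈ Zs := hZsc.csInf_mem hZsn hZsb
  have hτpos : 0 < τ := by linarith [hτmem.1]
  have hbefore : ∀ t ∈ Ioo 0 τ, Y₁ t < 0 := by
    intro t ht
    by_cases htε : t < ε
    · exact hneg t ⟨ht.1, htε⟩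
    · push Not at htε
      by_contra hle
      push Not at hle
      -- a zero of `Y₁` in `[ε/2, t]`, before `τ`
      have hivt := intermediate_value_Icc (show ε / 2 ≤ t by linarith) hY₁c.continuousOn
        (f := Y₁) (a := ε / 2) (b := t)
      have h0mem : (0 : ℝ) ∈ Icc (Y₁ (ε / 2)) (Y₁ t) :=
        ⟨(hneg _ ⟨by linarith, by linarith⟩).le, hle⟩
      obtain ⟨c, hc, hc0⟩ := hivt h0mem
      have hcZ : c ∈ Zs := ⟨hc.1, hc0⟩
      have := csInf_le hZsb hcZ
      linarith [hc.2, ht.2]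
  -- (D) `Y τ < Y 0`
  have hsa : StrictAntiOn Y (Icc 0 τ) :=
    strictAntiOn_of_deriv_neg (convex_Icc 0 τ) hYc.continuousOn fun x hx ↦ by
      rw [interior_Icc] at hx
      rw [hderY]; exact hbefore x hx
  have hYτ0 : Y τ < Y 0 := hsa ⟨le_rfl, hτpos.le⟩ ⟨hτpos.le, le_rfl⟩ hτpos
  -- (E) `Φ(Y τ) > 0`
  have hF0 : Y 0 - C * exp (Y 0) = 0 := by have := hnorm 0; rw [h0] at this; linarith
  have hFτ : Y τ - C * exp (Y τ) ≤ 0 := by have := hnorm τ; rw [hτmem.2] at this; linarith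
  have hpos := one_sub_mul_exp_pos_of_root hC hF0 hFτ hYτ0
  exact ⟨τ, hτpos, hτmem.2, hbefore, hYτ0, by linarith⟩

/-- **Energy identity of the profile**: along `y'' = ½ − (C/2) eʸ` the quantity
`y'² − (y − C eʸ)` is constant; if it vanishes at `0` it vanishes identically
(`(y'² − y + Ceʸ)' = 2y'y'' − y' + Ceʸ y' = 0`). [cite: Hamilton1988, §10] -/
theorem sq_deriv_eq_of_profile {C : ℝ} {Y Y₁ : ℝ → ℝ} (hY : ∀ t, HasDerivAt Y (Y₁ t) t)
    (hY₁ : ∀ t, HasDerivAt Y₁ (1 / 2 - C / 2 * exp (Y t)) t)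
    (h0 : Y₁ 0 ^ 2 = Y 0 - C * exp (Y 0)) (t : ℝ) : Y₁ t ^ 2 = Y t - C * exp (Y t) := by
  have hE : ∀ s, HasDerivAt (fun s ↦ Y₁ s ^ 2 - (Y s - C * exp (Y s))) 0 s := by
    intro s
    have h1 := (hY₁ s).pow 2
    have h2 := (hY s).sub (((Real.hasDerivAt_exp (Y s)).comp s (hY s)).const_mul C)
    refine (h1.sub h2).congr_deriv ?_
    simp only [Nat.cast_ofNat]
    ring
  have h := is_const_of_deriv_eq_zero (fun s ↦ (hE s).differentiableAt) (fun s ↦ (hE s).deriv) t 0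
  linarith


/-! ### Interval versions (data on an open time interval `(a, b) ∋ 0`) -/

/-- **Zero data for `u'' = −k(t) u` on an open interval force `u ≡ 0` there** (`k` continuous on
the interval). [folklore] -/
theorem eq_zero_of_hasDerivAt_two_linear_Ioo {k : ℝ → ℝ} {a b : ℝ} (hk : ContinuousOn k (Ioo a b))
    {u u₁ : ℝ → ℝ} (hu : ∀ t ∈ Ioo a b, HasDerivAt u (u₁ t) t)
    (hu₁ : ∀ t ∈ Ioo a b, HasDerivAt u₁ (-k t * u t) t) (h0 : u 0 = 0) (h0' : u₁ 0 = 0)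
    (hab : (0 : ℝ) ∈ Ioo a b) {t : ℝ} (ht : t ∈ Ioo a b) : u t = 0 := by
  -- a compact subinterval `[a', b'] ⊆ (a, b)` containing `0` and `t` in its interior
  set a' : ℝ := (a + min 0 t) / 2 with ha'
  set b' : ℝ := (b + max 0 t) / 2 with hb'
  have h1 : a < min 0 t := lt_min hab.1 ht.1
  have h2 : max 0 t < b := max_lt hab.2 ht.2
  have haa' : a < a' := by rw [ha']; linarith
  have ha'm : a' < min 0 t := by rw [ha']; linarith
  have hb'b : b' < b := by rw [hb']; linarith
  have hmb' : max 0 t < b' := by rw [hb']; linarith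
  have hsub : Icc a' b' ⊆ Ioo a b := fun s hs ↦ ⟨lt_of_lt_of_le haa' hs.1, lt_of_le_of_lt hs.2 hb'b⟩
  have hsub' : Ioo a' b' ⊆ Ioo a b := fun s hs ↦ hsub (Ioo_subset_Icc_self hs)
  obtain ⟨Kb, hKb⟩ := isCompact_Icc.exists_bound_of_continuousOn (hk.mono hsub)
  set K : NNReal := ⟨max Kb 1, le_trans zero_le_one (le_max_right _ _)⟩ with hK
  -- the first-order system
  set v : ℝ → ℝ × ℝ → ℝ × ℝ := fun s p ↦ (p.2, -k s * p.1) with hv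
  have hLip : ∀ s ∈ Ioo a' b', LipschitzOnWith K (v s) univ := by
    intro s hs
    refine LipschitzOnWith.of_dist_le_mul fun p _ q _ ↦ ?_
    have hks : |k s| ≤ max Kb 1 :=
      ((Real.norm_eq_abs _).symm.le.trans (hKb s (Ioo_subset_Icc_self hs))).trans (le_max_left _ _)
    rw [dist_eq_norm, dist_eq_norm, Prod.norm_def, Prod.norm_def]
    simp only [hv, Prod.fst_sub, Prod.snd_sub, Real.norm_eq_abs]
    have h1 : |p.2 - q.2| ≤ max |p.1 - q.1| |p.2 - q.2| := le_max_right _ _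
    have h2 : |(-k s * p.1) - (-k s * q.1)| ≤ max Kb 1 * max |p.1 - q.1| |p.2 - q.2| := by
      rw [show (-k s * p.1) - (-k s * q.1) = -k s * (p.1 - q.1) by ring, abs_mul, abs_neg]
      exact mul_le_mul hks (le_max_left _ _) (abs_nonneg _)
        (le_trans zero_le_one (le_max_right _ _))
    have hm : 0 ≤ max |p.1 - q.1| |p.2 - q.2| := le_trans (abs_nonneg _) (le_max_left _ _)
    refine max_le (h1.trans ?_) h2
    exact le_mul_of_one_le_left hm (le_max_right _ _)
  have hsol : ∀ s ∈ Ioo a' b', HasDerivAt (fun r ↦ (u r, u₁ r)) (v s (u s, u₁ s)) s ∧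
      (u s, u₁ s) ∈ (univ : Set (ℝ × ℝ)) := fun s hs ↦
    ⟨(hu s (hsub' hs)).prodMk (hu₁ s (hsub' hs)), mem_univ _⟩
  have hzero : ∀ s ∈ Ioo a' b', HasDerivAt (fun _ : ℝ ↦ ((0 : ℝ), (0 : ℝ))) (v s (0, 0)) s ∧
      ((0 : ℝ), (0 : ℝ)) ∈ (univ : Set (ℝ × ℝ)) := fun s _ ↦ by
    refine ⟨?_, mem_univ _⟩
    have : v s (0, 0) = (0, 0) := by simp [hv]
    rw [this]
    exact hasDerivAt_const s _
  have h00 : (0 : ℝ) ∈ Ioo a' b' :=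
    ⟨lt_of_lt_of_le ha'm (min_le_left _ _), lt_of_le_of_lt (le_max_left _ _) hmb'⟩
  have heq := ODE_solution_unique_of_mem_Ioo hLip h00 hsol hzero (by simp [h0, h0'])
  have htI : t ∈ Ioo a' b' :=
    ⟨lt_of_lt_of_le ha'm (min_le_right _ _), lt_of_le_of_lt (le_max_right _ _) hmb'⟩
  have := heq htI
  simp only [Prod.mk.injEq] at this
  exact this.1

/-- **Uniqueness for `u'' = −k(t) u` on an open interval** with prescribed `u(0)`, `u'(0)`.
[folklore] -/
theorem eq_of_hasDerivAt_two_linear_Ioo {k : ℝ → ℝ} {a b : ℝ} (hk : ContinuousOn k (Ioo a b))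
    {u u₁ w w₁ : ℝ → ℝ} (hu : ∀ t ∈ Ioo a b, HasDerivAt u (u₁ t) t)
    (hu₁ : ∀ t ∈ Ioo a b, HasDerivAt u₁ (-k t * u t) t) (hw : ∀ t ∈ Ioo a b, HasDerivAt w (w₁ t) t)
    (hw₁ : ∀ t ∈ Ioo a b, HasDerivAt w₁ (-k t * w t) t) (h0 : u 0 = w 0) (h0' : u₁ 0 = w₁ 0)
    (hab : (0 : ℝ) ∈ Ioo a b) {t : ℝ} (ht : t ∈ Ioo a b) : u t = w t := by
  have h := eq_zero_of_hasDerivAt_two_linear_Ioo hk (u := fun t ↦ u t - w t)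
    (u₁ := fun t ↦ u₁ t - w₁ t) (fun t ht ↦ (hu t ht).sub (hw t ht))
    (fun t ht ↦ ((hu₁ t ht).sub (hw₁ t ht)).congr_deriv (by ring)) (by simp [h0]) (by simp [h0'])
    hab ht
  linarith

/-- **`j = y'/a` on an open time interval**: interval version of `jacobi_eq_deriv_div` (the
Jacobi data `j`, `j₁` only given on `(a, b) ∋ 0`). [cite: Hamilton1988, §10] -/
theorem jacobi_eq_deriv_div_Ioo {C a₀ a b : ℝ} {Y Y₁ j j₁ : ℝ → ℝ}
    (hY : ∀ t, HasDerivAt Y (Y₁ t) t) (hY₁ : ∀ t, HasDerivAt Y₁ (1 / 2 - C / 2 * exp (Y t)) t)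
    (h0 : Y₁ 0 = 0) (ha : a₀ = 1 / 2 - C / 2 * exp (Y 0)) (ha0 : a₀ ≠ 0)
    (hj : ∀ t ∈ Ioo a b, HasDerivAt j (j₁ t) t)
    (hj₁ : ∀ t ∈ Ioo a b, HasDerivAt j₁ (-(C / 2 * exp (Y t)) * j t) t)
    (hj0 : j 0 = 0) (hj₁0 : j₁ 0 = 1) (hab : (0 : ℝ) ∈ Ioo a b) {t : ℝ} (ht : t ∈ Ioo a b) :
    j t = Y₁ t / a₀ ∧ j₁ t = (1 / 2 - C / 2 * exp (Y t)) / a₀ := by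
  have hk : Continuous fun t ↦ C / 2 * exp (Y t) :=
    continuous_const.mul (continuous_exp.comp
      (continuous_iff_continuousAt.2 fun s ↦ (hY s).continuousAt))
  have hu : ∀ t, HasDerivAt (fun t ↦ Y₁ t / a₀) ((1 / 2 - C / 2 * exp (Y t)) / a₀) t := fun t ↦
    (hY₁ t).div_const a₀
  have hu₁ : ∀ t, HasDerivAt (fun t ↦ (1 / 2 - C / 2 * exp (Y t)) / a₀)
      (-(C / 2 * exp (Y t)) * (Y₁ t / a₀)) t := fun t ↦ by
    have h := (((Real.hasDerivAt_exp (Y t)).comp t (hY t)).const_mul (C / 2)).const_sub (1 / 2)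
      |>.div_const a₀
    refine h.congr_deriv ?_
    ring
  have hjt : ∀ s ∈ Ioo a b, j s = Y₁ s / a₀ := fun s hs ↦
    eq_of_hasDerivAt_two_linear_Ioo hk.continuousOn hj hj₁ (fun t _ ↦ hu t) (fun t _ ↦ hu₁ t)
      (by rw [hj0, h0, zero_div]) (by rw [hj₁0, ← ha, div_self ha0]) hab hs
  refine ⟨hjt t ht, ?_⟩
  -- `j₁ = j' = (Y₁/a₀)'` on the interval
  have h1 : HasDerivAt j (j₁ t) t := hj t ht
  have h2 : HasDerivAt j ((1 / 2 - C / 2 * exp (Y t)) / a₀) t := by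
    refine (hu t).congr_of_eventuallyEq ?_
    filter_upwards [isOpen_Ioo.mem_nhds ht] with s hs
    exact hjt s hs
  exact h1.unique h2


end Literature.Analysis.ODE.ShrinkerLeafProfile

end
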